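import Literature.NumberTheory.EllipticCurves.LFunctionCoefficientBound
import HarnessLib

/-!
# Explicit coefficient bounds `|aₙ(E)| ≤ d(n) √n ≤ 2n` for elliptic curves over `ℚ`

Topic `NumberTheory/EllipticCurves`; companion of `LFunctionCoefficientBound`, which proves
`|a_{p^k}(E)| ≤ (k + 1) p^{k/2}` at every prime (`WeierstrassCurve.abs_LFunction_prime_pow_le`,
from Hasse's bound) and the asymptotic form `|aₙ(E)| ≤ 16²⁵⁶ · n^{5/8}`. Here we record the two
**numerically usable** forms of the same bound, with no large constant:

* `Nat.card_divisors_le_two_mul_sqrt`: `d(n) ≤ 2 ⌊√n⌋` (divisors pair off as `d ↦ n / d`);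
* `WeierstrassCurve.abs_LFunction_le_card_divisors_mul_sqrt`: `|aₙ(E)| ≤ d(n) · √n`
  (multiplicativity and the prime-power bound; Silverman, *AEC*, Thm. V.1.1, App. C §16);
* `WeierstrassCurve.abs_LFunction_le_two_mul_self`: `|aₙ(E)| ≤ 2n` for all `n`.

These are the bounds one feeds into explicit truncation-tail estimates for the series
`L^{(r)}(E, 1) = 2 r! ∑ (aₙ/n) G_r(2πn/√N)` of Buhler–Gross–Zagier (Math. Comp. 44 (1985), (12)).

## References

* J. H. Silverman, *The Arithmetic of Elliptic Curves*, 2nd ed., GTM 106, Thm. V.1.1, App. C §16.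
* J. P. Buhler, B. H. Gross, D. B. Zagier, *On the conjecture of Birch and Swinnerton-Dyer for an
  elliptic curve of rank 3*, Math. Comp. 44 (1985) 473–481, eq. (12).
-/

noncomputable section

open scoped BigOperators
open ArithmeticFunction Finset

/-- **`d(n) ≤ 2⌊√n⌋`**: every divisor `d` of `n ≠ 0` has `d ≤ √n` or `n / d ≤ √n`, and
`d ↦ n / d` is injective on the divisors of `n` («it is trivial that d(n) < 2√n»).
[cite: HardyWright2008, §18.1] -/
theorem Nat.card_divisors_le_two_mul_sqrt (n : ℕ) : n.divisors.card ≤ 2 * Nat.sqrt n := by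
  rcases eq_or_ne n 0 with rfl | hn
  · simp
  set s := Nat.sqrt n with hs
  -- the small divisors
  have hA : (n.divisors.filter (· ≤ s)).card ≤ s := by
    calc (n.divisors.filter (· ≤ s)).card ≤ (Finset.Icc 1 s).card :=
          Finset.card_le_card fun d hd ↦ by
            simp only [Finset.mem_filter, Nat.mem_divisors] at hd
            exact Finset.mem_Icc.mpr ⟨Nat.pos_of_dvd_of_pos hd.1.1 (Nat.pos_of_ne_zero hn), hd.2⟩
      _ = s := by simp
  -- the large divisors inject into the small ones under `d ↦ n / d`
  have hB : (n.divisors.filter fun d ↦ ¬ d ≤ s).card ≤ (n.divisors.filter (· ≤ s)).card := by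
    refine Finset.card_le_card_of_injOn (fun d ↦ n / d) (fun d hd ↦ ?_) (fun d₁ hd₁ d₂ hd₂ h ↦ ?_)
    · simp only [Finset.coe_filter, Set.mem_setOf_eq, Nat.mem_divisors] at hd ⊢
      obtain ⟨⟨hdn, -⟩, hds⟩ := hd
      refine ⟨⟨Nat.div_dvd_of_dvd hdn, hn⟩, ?_⟩
      by_contra h
      have h1 : s + 1 ≤ d := Nat.succ_le_of_lt (not_le.mp hds)
      have h2 : s + 1 ≤ n / d := Nat.succ_le_of_lt (not_le.mp h)
      have h3 : (s + 1) * (s + 1) ≤ d * (n / d) := Nat.mul_le_mul h1 h2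
      rw [Nat.mul_div_cancel' hdn] at h3
      exact absurd h3 (not_le.mpr (Nat.lt_succ_sqrt n))
    · simp only [Finset.coe_filter, Set.mem_setOf_eq, Nat.mem_divisors] at hd₁ hd₂
      have e₁ : n / (n / d₁) = d₁ := Nat.div_div_self hd₁.1.1 hn
      have e₂ : n / (n / d₂) = d₂ := Nat.div_div_self hd₂.1.1 hn
      simp only at h
      rw [← e₁, ← e₂, h]
  calc n.divisors.card
      = (n.divisors.filter (· ≤ s)).card + (n.divisors.filter fun d ↦ ¬ d ≤ s).card :=
        (Finset.card_filter_add_card_filter_not _).symm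
    _ ≤ s + s := add_le_add hA (hB.trans hA)
    _ = 2 * s := (two_mul s).symm

namespace WeierstrassCurve

/-- `d(n) = ∏_{p^k ∥ n} (k + 1)` via the multiplicativity of `σ₀`. [cite: HardyWright2008, Thm 273 (§16.7)] -/
theorem card_divisors_eq_prod_factorization_succ {n : ℕ} (hn : n ≠ 0) :
    (n.divisors.card : ℝ) = ∏ p ∈ n.factorization.support, ((n.factorization p : ℝ) + 1) := by
  have h := (isMultiplicative_sigma (k := 0)).multiplicative_factorization (sigma 0) hn
  rw [sigma_zero_apply] at h
  rw [h, Finsupp.prod, Nat.cast_prod]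
  refine Finset.prod_congr rfl fun p hp ↦ ?_
  have hpp : p.Prime := Nat.prime_of_mem_primeFactors (Nat.support_factorization n ▸ hp)
  rw [sigma_zero_apply_prime_pow hpp]
  push_cast
  ring

/-- **`|aₙ(E)| ≤ d(n) √n`** for every elliptic curve `E / ℚ` and every `n`: multiplicativity of
the coefficients and `|a_{p^k}| ≤ (k + 1) p^{k/2}` (Hasse) at every prime power.
[cite: SilvermanAEC2009, Thm. V.1.1, App. C §16] -/
theorem abs_LFunction_le_card_divisors_mul_sqrt (W : WeierstrassCurve ℚ) [W.IsElliptic] (n : ℕ) :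
    |(W.LFunction n : ℝ)| ≤ n.divisors.card * Real.sqrt n := by
  rcases Nat.eq_zero_or_pos n with rfl | hn
  · simp
  have hmult := W.isMultiplicative_LFunction
  rw [hmult.multiplicative_factorization W.LFunction hn.ne']
  -- `√n = ∏ √p ^ k`
  have hcast : (n : ℝ) = ∏ p ∈ n.factorization.support, (p : ℝ) ^ n.factorization p := by
    conv_lhs => rw [← Nat.prod_factorization_pow_eq_self hn.ne']
    rw [Finsupp.prod, Nat.cast_prod]
    push_cast
    rfl
  have hsqrt : Real.sqrt n = ∏ p ∈ n.factorization.support, Real.sqrt p ^ n.factorization p := by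
    rw [hcast, Real.sqrt_eq_rpow, ← Real.finsetProd_rpow _ _ (fun p _ ↦ by positivity)]
    refine Finset.prod_congr rfl fun p _ ↦ ?_
    rw [Real.sqrt_eq_rpow, ← Real.rpow_natCast, ← Real.rpow_natCast,
      ← Real.rpow_mul (by positivity), ← Real.rpow_mul (by positivity), mul_comm]
  rw [hsqrt, card_divisors_eq_prod_factorization_succ hn.ne', ← Finset.prod_mul_distrib,
    Finsupp.prod, Int.cast_prod, Finset.abs_prod]
  refine Finset.prod_le_prod (fun p _ ↦ abs_nonneg _) fun p hp ↦ ?_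
  have hpp : p.Prime := Nat.prime_of_mem_primeFactors (Nat.support_factorization n ▸ hp)
  exact W.abs_LFunction_prime_pow_le hpp _

/-- **`|aₙ(E)| ≤ 2n`** for every elliptic curve `E / ℚ` and every `n` (from `|aₙ| ≤ d(n)√n`
and `d(n) ≤ 2√n`) — the form used for explicit truncation tails of the Buhler–Gross–Zagier
series. [cite: SilvermanAEC2009, Thm. V.1.1, App. C §16] [cite: HardyWright2008, §18.1] -/
theorem abs_LFunction_le_two_mul_self (W : WeierstrassCurve ℚ) [W.IsElliptic] (n : ℕ) :
    |(W.LFunction n : ℝ)| ≤ 2 * n := by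
  have h1 := W.abs_LFunction_le_card_divisors_mul_sqrt n
  have h2 : (n.divisors.card : ℝ) ≤ 2 * Real.sqrt n := by
    calc (n.divisors.card : ℝ) ≤ ((2 * Nat.sqrt n : ℕ) : ℝ) := by
          exact_mod_cast Nat.card_divisors_le_two_mul_sqrt n
      _ = 2 * (Nat.sqrt n : ℝ) := by push_cast; ring
      _ ≤ 2 * Real.sqrt n := by
          have := Real.nat_sqrt_le_real_sqrt (a := n)
          linarith
  have hs : 0 ≤ Real.sqrt n := Real.sqrt_nonneg _
  calc |(W.LFunction n : ℝ)| ≤ n.divisors.card * Real.sqrt n := h1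
    _ ≤ 2 * Real.sqrt n * Real.sqrt n := mul_le_mul_of_nonneg_right h2 hs
    _ = 2 * n := by rw [mul_assoc, Real.mul_self_sqrt (Nat.cast_nonneg n)]

end WeierstrassCurve

end
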